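import Summits.QuantumFields.YangMills.Theorems.InfiniteVolumeTranslations
import Summits.QuantumFields.YangMills.Theorems.InfiniteVolumePermutations
import Summits.QuantumFields.YangMills.Theorems.BalabanLadderInfVolCeilingsDefs
import Summits.QuantumFields.YangMills.Theorems.LangevinControlUVOSLegsFromFemtoAndGapStubAssemblySoftLegs
import Summits.QuantumFields.YangMills.Theorems.LangevinControlUVOSLegsFromFemtoAndGapStubAssemblyPlaneExpansion
import HarnessLib

/-!
# Infinite volume by compactness, step 9: the one-field Schwinger data of the «`L → ∞` first» route — existence with
# E0, E0′, E3 and translation invariance (the p2 half of support `IVData`)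

HONEST FRAMING (cell `ym-fleet`, seat `ym-infvol-p2`, director-ym R136 (i) «INFINITE-VOLUME ∕ CONTINUUM-FROM-UV
ROUTE»; support `IVData` of the planner's DESIGN 2026-08-26T17:44:53Z, p2 = lead; bears on LADDER-YM R1∕R2a).  Pure
soft analysis, kernel-checked.  The only Yang–Mills input is the spine's UV-leg currency `MomentBounds6 G r a`
(HYPOTHESIS).  NOTHING here about rotations (E1's other half, `ROT`), reflection positivity (E2, seat p3),
non-triviality ∕ non-Gaussianity (the NT∕NG half of `IVData`, seat p1, from `LowerBounds`), clustering, uniqueness of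
the infinite-volume state, a mass gap, or Clay.

THE THEOREM (`exists_ivData_core`).  For every compact `G`, lattice representation `r` and unit map `a` with
`a > 0`, `a → 0` and `MomentBounds6 G r a`, there are a coupling sequence `β_k → ∞`, thermodynamic limit states
`μ_k ∈ oddTorusLimitPoints r (β_k)` of the torus-projective family, plane-string limit functionals `T n q` and a
one-field family `S₁` (`S₁ 0 F = F default`, `S₁ 1 = 0`, `S₁ n = Σ_{q valid} T n q` for `n ≥ 2`) such that, with
PLAQUETTE-CENTRE smearing `x_l ↦ a_k·x_l + (a_k/2)(e_{(q l).1} + e_{(q l).2})` (the planner's DATA clause, written with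
p1's `stateMomentStr`): for `n ≥ 2`, valid `q`, `F ∈ ⁰𝒮ₙ` the infinite-volume series of `μ_k` converge to `T n q F`
(full sequence, after re-indexing along the compactness subsequence), and `S₁` is normalised (E0), of linear growth
(E0′, from `‖T n q F‖ ≤ 5Kⁿ‖F‖_{10n}`), symmetric (E3, step 8) and translation invariant on `⁰𝒮` (step 4).  Also
exported: the `T`-bound with its constant, `0 < a(β_k) ≤ 1/24`, `a(β_k) → 0`.

References: Osterwalder–Schrader CMP 31 (1973) §2, CMP 42 (1975) §2; Glimm–Jaffe (1987) §6.1.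
-/

set_option autoImplicit false

noncomputable section

open scoped BigOperators SchwartzMap
open MeasureTheory Filter Topology
open Literature.MathematicalPhysics.QuantumFieldTheory hiding ZdEdge
open Literature.MathematicalPhysics.QuantumLattice
open Literature.MathematicalPhysics.AQFT
open Literature.Probability.LatticeModels (box Site)
open Summit.QuantumFields.YangMills.Cruxes.OSLegsFromFemtoAndGap.DlrCollarTransfer (plane MomentBounds6)
open Summit.QuantumFields.YangMills.Theorems.OSLegsFromFemtoAndGap (card_planes pow_le_exp_mul_factorial)

namespace Summit.QuantumFields.YangMills.Theorems.InfiniteVolume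

variable {G : Type} [Group G] [TopologicalSpace G] [IsTopologicalGroup G] [CompactSpace G]
  [MeasurableSpace G] [BorelSpace G]

/-- The number of valid plane strings of length `n` is `6ⁿ`. [folklore] -/
theorem card_validStrings (n : ℕ) :
    ((Fintype.piFinset (fun _ : Fin n => Finset.univ.filter fun p : Fin 4 × Fin 4 => p.1 < p.2)).card : ℝ) =
      6 ^ n := by
  rw [Fintype.card_piFinset, Finset.prod_const, Finset.card_univ, Fintype.card_fin, card_planes]; push_cast; ring

/-- The plaquette-centre offset `(a/2)·(e_i + e_j)` has norm `≤ a ≤ 5a` for `0 ≤ a`. [folklore] -/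
theorem norm_centreOffset_le {a : ℝ} (ha : 0 ≤ a) (p : Fin 4 × Fin 4) :
    ‖(a / 2) • (EuclideanSpace.single p.1 (1 : ℝ) + EuclideanSpace.single p.2 (1 : ℝ))‖ ≤ 5 * a := by
  rw [norm_smul, Real.norm_of_nonneg (by positivity : (0 : ℝ) ≤ a / 2)]
  have h : ‖EuclideanSpace.single p.1 (1 : ℝ) + EuclideanSpace.single p.2 (1 : ℝ)‖ ≤ 2 := by
    have h1 : ‖EuclideanSpace.single p.1 (1 : ℝ)‖ = 1 := by
      rw [show EuclideanSpace.single p.1 (1 : ℝ) = PiLp.single 2 p.1 (1 : ℝ) from rfl,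
        PiLp.norm_single 2 (fun _ : Fin 4 => ℝ) p.1 (1 : ℝ), norm_one]
    have h2 : ‖EuclideanSpace.single p.2 (1 : ℝ)‖ = 1 := by
      rw [show EuclideanSpace.single p.2 (1 : ℝ) = PiLp.single 2 p.2 (1 : ℝ) from rfl,
        PiLp.norm_single 2 (fun _ : Fin 4 => ℝ) p.2 (1 : ℝ), norm_one]
    calc _ ≤ ‖EuclideanSpace.single p.1 (1 : ℝ)‖ + ‖EuclideanSpace.single p.2 (1 : ℝ)‖ := norm_add_le _ _
      _ = 2 := by rw [h1, h2]; norm_num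
  nlinarith

/-- **THE p2 HALF OF `IVData`** (module docstring): existence of the «`L → ∞` first» one-field data with E0, E0′,
E3 and translation invariance, from `MomentBounds6 G r a`, `a > 0`, `a → 0`. [folklore] -/
theorem exists_ivData_core (r : LatticeRep G) {a : ℝ → ℝ} (hapos : ∀ β, 0 < a β)
    (ha0 : Tendsto a atTop (𝓝 0)) (hMB : MomentBounds6 G r a) :
    ∃ (β : ℕ → ℝ) (μ : ℕ → Measure (LGConfig 4 G)) (S₁ : SchwingerFamily (EuclideanSpace ℝ (Fin 4)))
      (T : (n : ℕ) → (Fin n → Fin 4 × Fin 4) → (𝓢((Fin n → EuclideanSpace ℝ (Fin 4)), ℂ) →L[ℂ] ℂ)),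
      Tendsto β atTop atTop ∧ (∀ k, μ k ∈ oddTorusLimitPoints r (β k)) ∧
      (∀ F : 𝓢((Fin 0 → EuclideanSpace ℝ (Fin 4)), ℂ), S₁ 0 F = F default) ∧
      (∀ F : 𝓢((Fin 1 → EuclideanSpace ℝ (Fin 4)), ℂ), S₁ 1 F = 0) ∧
      (∀ n : ℕ, 2 ≤ n → ∀ F : 𝓢((Fin n → EuclideanSpace ℝ (Fin 4)), ℂ),
        S₁ n F = ∑ q ∈ Fintype.piFinset (fun _ : Fin n => Finset.univ.filter fun p : Fin 4 × Fin 4 => p.1 < p.2),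
          T n q F) ∧
      (∀ n : ℕ, 2 ≤ n → ∀ q : Fin n → Fin 4 × Fin 4, (∀ i, (q i).1 < (q i).2) →
        ∀ F : 𝓢((Fin n → EuclideanSpace ℝ (Fin 4)), ℂ), IsOffDiagonal F →
          Tendsto (fun k => ∑' x : Fin n → Site 4, ((stateMomentStr G r (μ k) n q x : ℝ) : ℂ) *
            F (fun l => a (β k) • siteToE (x l) +
              (a (β k) / 2) • (EuclideanSpace.single (q l).1 (1 : ℝ) + EuclideanSpace.single (q l).2 (1 : ℝ))))
            atTop (𝓝 (T n q F))) ∧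
      S₁.toLabelled.IsNormalized ∧ S₁.toLabelled.HasLinearGrowth ∧ S₁.toLabelled.IsSymmetric ∧
      (∀ (n : ℕ) (t : EuclideanSpace ℝ (Fin 4)) (F : 𝓢((Fin n → EuclideanSpace ℝ (Fin 4)), ℂ)), IsOffDiagonal F →
        S₁ n (translateMulti t F) = S₁ n F) ∧
      (∃ K : ℝ, 0 ≤ K ∧ (∀ n q F, ‖T n q F‖ ≤ 5 * K ^ n * schwartzNorm (10 * n) F) ∧
        ∀ n F, ‖S₁ n F‖ ≤ 5 * (6 * K) ^ n * schwartzNorm (10 * n) F) ∧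
      (∀ k, 0 < a (β k)) ∧ (∀ k, a (β k) ≤ 1 / 24) ∧ Tendsto (fun k => a (β k)) atTop (𝓝 0) := by
  classical
  obtain ⟨β₄, ℓ₄, K, hℓ, hK, Hex⟩ := exists_subseq_limit_translate_oddTorusLimitPoints r hMB
  -- couplings above every threshold, with `a` below every threshold
  obtain ⟨B₁, hB₁⟩ : ∃ B₁ : ℝ, ∀ β, B₁ ≤ β → a β < min (1 / 24) ℓ₄ :=
    Filter.eventually_atTop.1 (ha0.eventually (gt_mem_nhds (by positivity)))
  set βs : ℕ → ℝ := fun k => max β₄ B₁ + (k : ℝ) with hβs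
  have hβs4 : ∀ k, β₄ ≤ βs k := fun k => by
    simp only [hβs]; linarith [le_max_left β₄ B₁, (Nat.cast_nonneg k : (0 : ℝ) ≤ k)]
  have hβs1 : ∀ k, B₁ ≤ βs k := fun k => by
    simp only [hβs]; linarith [le_max_right β₄ B₁, (Nat.cast_nonneg k : (0 : ℝ) ≤ k)]
  have hβs_top : Tendsto βs atTop atTop := tendsto_atTop_add_const_left atTop _ tendsto_natCast_atTop_atTop
  have ha_pos : ∀ k, 0 < a (βs k) := fun k => hapos _
  have ha_24 : ∀ k, a (βs k) ≤ 1 / 24 := fun k => (hB₁ _ (hβs1 k)).le.trans (min_le_left _ _)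
  have ha_ℓ : ∀ k, a (βs k) ≤ ℓ₄ := fun k => (hB₁ _ (hβs1 k)).le.trans (min_le_right _ _)
  have ha_top : Tendsto (fun k => a (βs k)) atTop (𝓝 0) := ha0.comp hβs_top
  -- thermodynamic limit states along one odd-torus sequence
  obtain ⟨S, -, μ, hμ⟩ := exists_strictMono_forall_mem_oddTorusLimitPoints r βs
  have hμmem : ∀ k, μ k ∈ oddTorusLimitPoints r (βs k) := fun k => (hμ k).2.1
  -- plaquette-centre offsets
  set o : ℕ → (n : ℕ) → (Fin n → Fin 4 × Fin 4) → Fin n → EuclideanSpace ℝ (Fin 4) := fun k n q l =>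
    (a (βs k) / 2) • (EuclideanSpace.single (q l).1 (1 : ℝ) + EuclideanSpace.single (q l).2 (1 : ℝ)) with ho
  have hob : ∀ k n (q : Fin n → Fin 4 × Fin 4) l, ‖o k n q l‖ ≤ 5 * a (βs k) := fun k n q l =>
    norm_centreOffset_le (ha_pos k).le (q l)
  -- the compactness step with translations
  obtain ⟨φ, hφ, T, hTb, hconv, htrans⟩ := Hex βs hβs4 ha_pos ha_24 ha_ℓ ha_top μ hμmem o hob
  -- the one-field family
  let P : (n : ℕ) → Finset (Fin n → Fin 4 × Fin 4) := fun n =>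
    Fintype.piFinset (fun _ : Fin n => Finset.univ.filter fun p : Fin 4 × Fin 4 => p.1 < p.2)
  let S₁ : SchwingerFamily (EuclideanSpace ℝ (Fin 4)) := fun n =>
    if n = 0 then LabelledSchwingerFamily.evalAt default else if n = 1 then 0 else ∑ q ∈ P n, T n q
  have hS₁0' : S₁ 0 = LabelledSchwingerFamily.evalAt default := rfl
  have hS₁1' : S₁ 1 = 0 := rfl
  have hS₁0 : ∀ F : 𝓢((Fin 0 → EuclideanSpace ℝ (Fin 4)), ℂ), S₁ 0 F = F default := fun F => by
    rw [hS₁0', LabelledSchwingerFamily.evalAt_apply]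
  have hS₁1 : ∀ F : 𝓢((Fin 1 → EuclideanSpace ℝ (Fin 4)), ℂ), S₁ 1 F = 0 := fun F => by
    rw [hS₁1']; rfl
  have hS₁2 : ∀ n : ℕ, 2 ≤ n → ∀ F : 𝓢((Fin n → EuclideanSpace ℝ (Fin 4)), ℂ),
      S₁ n F = ∑ q ∈ P n, T n q F := fun n hn F => by
    have h : S₁ n = ∑ q ∈ P n, T n q := by
      simp only [S₁, if_neg (show n ≠ 0 by omega), if_neg (show n ≠ 1 by omega)]
    rw [h, FunLike.coe_sum, Finset.sum_apply]
  -- the convergence clause along the re-indexed sequence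
  have hconv' : ∀ n : ℕ, 2 ≤ n → ∀ q : Fin n → Fin 4 × Fin 4, (∀ i, (q i).1 < (q i).2) →
      ∀ F : 𝓢((Fin n → EuclideanSpace ℝ (Fin 4)), ℂ), IsOffDiagonal F →
        Tendsto (fun k => ∑' x : Fin n → Site 4, ((stateMomentStr G r (μ (φ k)) n q x : ℝ) : ℂ) *
          F (fun l => a (βs (φ k)) • siteToE (x l) +
            (a (βs (φ k)) / 2) • (EuclideanSpace.single (q l).1 (1 : ℝ) + EuclideanSpace.single (q l).2 (1 : ℝ))))
          atTop (𝓝 (T n q F)) := fun n hn q hq F hF => hconv n hn q hq F hF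
  -- the uniform bounds
  have hbdS₁ : ∀ n (F : 𝓢((Fin n → EuclideanSpace ℝ (Fin 4)), ℂ)),
      ‖S₁ n F‖ ≤ 5 * (6 * K) ^ n * schwartzNorm (10 * n) F := by
    intro n F
    rcases Nat.lt_or_ge n 2 with hn | hn
    · interval_cases n
      · rw [hS₁0]
        have h1 := norm_le_schwartzNorm 0 F default
        have h0 := schwartzNorm_nonneg 0 F
        simp only [pow_zero, mul_one, mul_zero]
        linarith
      · rw [hS₁1, norm_zero]; exact mul_nonneg (by positivity) (schwartzNorm_nonneg _ _)
    · rw [hS₁2 n hn]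
      calc _ ≤ ∑ q ∈ P n, ‖T n q F‖ := norm_sum_le _ _
        _ ≤ ∑ _q ∈ P n, 5 * K ^ n * schwartzNorm (10 * n) F := Finset.sum_le_sum fun q _ => hTb n q F
        _ = 6 ^ n * (5 * K ^ n * schwartzNorm (10 * n) F) := by
            rw [Finset.sum_const, nsmul_eq_mul, card_validStrings]
        _ = 5 * (6 * K) ^ n * schwartzNorm (10 * n) F := by rw [mul_pow]; ring
  refine ⟨fun k => βs (φ k), fun k => μ (φ k), S₁, T, hβs_top.comp hφ.tendsto_atTop, fun k => hμmem (φ k),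
    hS₁0, hS₁1, hS₁2, hconv', fun _ F => ?_, ?_, ?_, ?_, ⟨K, hK, hTb, hbdS₁⟩, fun k => ha_pos _,
    fun k => ha_24 _, ha_top.comp hφ.tendsto_atTop⟩
  · -- E0
    rw [SchwingerFamily.toLabelled_apply, hS₁0]
    exact congrArg F (Subsingleton.elim _ _)
  · -- E0′
    intro _
    have h6K : 0 ≤ 6 * K := by positivity
    refine ⟨10, 5 * Real.exp (6 * K), 1, fun n k _ F _ => ?_⟩
    simp only [SchwingerFamily.toLabelled_apply, Real.rpow_one]
    calc ‖S₁ n F‖ ≤ 5 * (6 * K) ^ n * schwartzNorm (10 * n) F := hbdS₁ n F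
      _ ≤ 5 * (Real.exp (6 * K) * (n.factorial : ℝ)) * schwartzNorm (10 * n) F := by
          gcongr
          · exact schwartzNorm_nonneg _ _
          · exact pow_le_exp_mul_factorial h6K n
      _ = 5 * Real.exp (6 * K) * (n.factorial : ℝ) * schwartzNorm (n * 10) F := by rw [mul_comm n 10]; ring
  · -- E3
    intro n k π F hF
    simp only [SchwingerFamily.toLabelled_apply]
    rcases Nat.lt_or_ge n 2 with hn | hn
    · interval_cases n
      · rw [hS₁0, hS₁0]
        exact (permTest_apply π F default).trans (congrArg F (Subsingleton.elim _ _))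
      · rw [hS₁1, hS₁1]
    · rw [hS₁2 n hn, hS₁2 n hn]
      exact sum_limit_permTest_eq r (fun k => μ (φ k)) (fun k => a (βs (φ k)))
        (fun k p => (a (βs (φ k)) / 2) • (EuclideanSpace.single p.1 (1 : ℝ) + EuclideanSpace.single p.2 (1 : ℝ)))
        (fun q F => T n q F) (fun q hq F' hF' => hconv n hn q hq F' hF') π F hF
  · -- translations
    intro n t F hF
    rcases Nat.lt_or_ge n 2 with hn | hn
    · interval_cases n
      · rw [hS₁0, hS₁0]
        exact (translateMulti_apply t F default).trans (congrArg F (Subsingleton.elim _ _))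
      · rw [hS₁1, hS₁1]
    · rw [hS₁2 n hn, hS₁2 n hn]
      refine Finset.sum_congr rfl fun q hq => ?_
      have hqv : ∀ i, (q i).1 < (q i).2 := fun i => by
        have := (Fintype.mem_piFinset.1 hq) i
        exact (Finset.mem_filter.1 this).2
      exact htrans n hn q hqv t F hF

end Summit.QuantumFields.YangMills.Theorems.InfiniteVolume

end
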